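import Literature.MathematicalPhysics.QuantumLattice.AnisotropicHeisenbergTwoSumRule
import Literature.MathematicalPhysics.QuantumLattice.AnisotropicKLSIntegral
import HarnessLib

/-!
# Kennedy–Lieb–Shastry's model (5): the two-sum-rule integrals and Néel order of the layered
# spin-`S` Heisenberg antiferromagnet conditional on a certified evaluation of the LP (`d ≥ 3`)

Topic `MathematicalPhysics/QuantumLattice`; completes `AnisotropicHeisenbergTwoSumRule.lean` by
"passing from sums to integrals" exactly as `AnisotropicKLSIntegral.lean` does for the XY version:
the punctured Riemann sums `𝓦^K_{t,μ}(L)` (`heisAnisoKlsRiemannSum`) of the two-sum-rule bound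
converge along the even sides to
`𝓘^K_{t,μ} = (2π)^{-d} ∫_{[-π,π]^d} {t - Σᵢ μᵢ cos pᵢ}₊ [Σᵢ Kᵢ(1 + cos pᵢ) / Σᵢ Kᵢ(1 - cos pᵢ)]^{1/2} dp`
(`heisAnisoKlsIntegral`; the substitution `q = p + Q` of [KLS1988JSP] after eq. (19)), for
`K > 0` and `d ≥ 3`, by the tree's punctured-Riemann-sum theorem for symbols with an integrable
`1/E` singularity (`PuncturedRiemannSum.momentumAverage_singular_approx`); the integrand is
integrable on the zone (`integrableOn_heisAnisoKlsIntegrand`). Consequently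
(`heisAniso_neelLRO_of_integral_certificate`, `heisAniso_neelLRO_of_integral_dirCertificate`,
`layeredHeis_neelLRO_of_certificate`) the ground states of `H_K = Σ_x Σᵢ Kᵢ 𝐒_x·𝐒_{x+eᵢ}` on the
even tori `(ℤ/2kℤ)^d` have Néel long-range order as soon as finitely many values
`W̄ⱼ > 𝓘^K_{tⱼ,μⱼ}` and a real-arithmetic certificate covering the a-priori region of the unknown
bond correlations are supplied — for `K = (1, 1, r)`, `S = ½` this is [KLS1988JSP]'s
"Néel order if `1 ≥ r ≥ 0.16`" with the numerical evaluation of (6)–(9) left as the explicit input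
(as the tree does for the isotropic case in `kennedy_lieb_shastry_ground_of_riemannSum_three`).
One definition of the integrand and one of the integral; no named fact. Nothing numerical is
asserted.

## References

* [KLS1988JSP] T. Kennedy, E. H. Lieb, B. S. Shastry, J. Stat. Phys. 53 (1988) 1019–1030, §3,
  eqs. (5)–(9), p. 1023 ("For a given value of `r`, we determine `α` by numerically computing the
  integral in (8) using (9). With this `α` we then compute `I`"), after eq. (19) (`q ↦ q - Q`).
* [KLS1988PRL] T. Kennedy, E. H. Lieb, B. S. Shastry, Phys. Rev. Lett. 61 (1988) 2582–2584,
  before eq. (2) ("passing from sums to integrals").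
* [DLS1978] F. J. Dyson, E. H. Lieb, B. Simon, J. Stat. Phys. 18 (1978) 335–383, §3.
-/

noncomputable section

open MeasureTheory Filter Topology Finset
open Literature.MathematicalPhysics.QuantumLattice Literature.Probability.LatticeModels
  Literature.MathematicalPhysics.QuantumFieldTheory.Balaban1983to89.Beta

namespace Literature.MathematicalPhysics.QuantumLattice

variable {d : ℕ}

/-! ### The two-sum-rule integrand (after the shift `q = p + Q`) and its integral -/

/-- **The two-sum-rule integrand of the model (5)** after the substitution `q = p + Q`:
`G^K_{t,μ}(p) = {t - Σᵢ μᵢ cos pᵢ}₊ [Σᵢ Kᵢ(1 + cos pᵢ) / Σᵢ Kᵢ(1 - cos pᵢ)]^{1/2}`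
(`cos qᵢ = -cos pᵢ`, `E^K_q = Σᵢ Kᵢ(1 + cos pᵢ)`, `E^K_{q-Q} = E^K_p`); for `μ = λK`, `K = (1,1,r)`
the integrand of [KLS1988JSP] (6)–(9). [cite: KLS1988JSP, eqs. (6)-(9)] -/
def heisAnisoKlsIntegrand (K : Fin d → ℝ) (t : ℝ) (μ : Fin d → ℝ) (p : Fin d → ℝ) : ℝ :=
  max (t - ∑ i, μ i * Real.cos (p i)) 0 *
    Real.sqrt ((∑ i, K i * (1 + Real.cos (p i))) / NVectorAniso.anisoDispersion K p)

/-- **The two-sum-rule integral** `𝓘^K_{t,μ} = (2π)^{-d} ∫_{[-π,π]^d} G^K_{t,μ}(p) dp` — the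
quantity KLS evaluate numerically ("we determine `α` by numerically computing the integral in (8)
using (9). With this `α` we then compute `I`", p. 1023). [cite: KLS1988JSP, eqs. (6)-(9), p. 1023] -/
def heisAnisoKlsIntegral (K : Fin d → ℝ) (t : ℝ) (μ : Fin d → ℝ) : ℝ :=
  (∫ p in brillouin d, heisAnisoKlsIntegrand K t μ p) / (2 * Real.pi) ^ d

section Integrand

variable {K : Fin d → ℝ}

/-- `G^K_{t,μ} ≥ 0`. [cite: KLS1988JSP, eqs. (6)-(9)] -/
theorem heisAnisoKlsIntegrand_nonneg (K : Fin d → ℝ) (t : ℝ) (μ : Fin d → ℝ) (p : Fin d → ℝ) :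
    0 ≤ heisAnisoKlsIntegrand K t μ p :=
  mul_nonneg (le_max_right _ _) (Real.sqrt_nonneg _)

/-- `G^K_{t,μ}` is `2π`-periodic in every coordinate. [cite: KLS1988JSP, eqs. (6)-(9)] -/
theorem heisAnisoKlsIntegrand_add_two_pi_mul_int (K : Fin d → ℝ) (t : ℝ) (μ : Fin d → ℝ)
    (p : Fin d → ℝ) (z : Fin d → ℤ) :
    heisAnisoKlsIntegrand K t μ (fun i => p i + 2 * Real.pi * (z i : ℝ)) =
      heisAnisoKlsIntegrand K t μ p := by
  have hc : ∀ i, Real.cos (p i + 2 * Real.pi * (z i : ℝ)) = Real.cos (p i) := fun i => by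
    rw [show p i + 2 * Real.pi * (z i : ℝ) = p i + (z i : ℝ) * (2 * Real.pi) by ring,
      Real.cos_add_int_mul_two_pi]
  simp only [heisAnisoKlsIntegrand, NVectorAniso.anisoDispersion, hc]

/-- `G^K_{t,μ}` is continuous at every `p` with `E^K_p > 0`. [cite: KLS1988JSP, eqs. (6)-(9)] -/
theorem continuousAt_heisAnisoKlsIntegrand (K : Fin d → ℝ) (t : ℝ) (μ : Fin d → ℝ) {p : Fin d → ℝ}
    (hp : 0 < NVectorAniso.anisoDispersion K p) :
    ContinuousAt (heisAnisoKlsIntegrand K t μ) p := by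
  have hcos : ∀ i : Fin d, Continuous fun p : Fin d → ℝ => Real.cos (p i) := fun i =>
    Real.continuous_cos.comp (continuous_apply i)
  have hk : Continuous fun p : Fin d → ℝ => max (t - ∑ i, μ i * Real.cos (p i)) 0 :=
    ((continuous_const.sub (continuous_finsetSum _ fun i _ =>
      continuous_const.mul (hcos i))).max continuous_const)
  have hN : Continuous fun p : Fin d → ℝ => ∑ i, K i * (1 + Real.cos (p i)) :=
    continuous_finsetSum _ fun i _ => continuous_const.mul (continuous_const.add (hcos i))
  have hE : Continuous fun p : Fin d → ℝ => NVectorAniso.anisoDispersion K p := by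
    unfold NVectorAniso.anisoDispersion
    exact continuous_finsetSum _ fun i _ => continuous_const.mul (continuous_const.sub (hcos i))
  unfold heisAnisoKlsIntegrand
  exact hk.continuousAt.mul ((hN.continuousAt.div hE.continuousAt hp.ne').sqrt)

/-- The `1/E` majorant: for `0 < m ≤ Kᵢ`, `p ∈ [-π,π]^d \ {0}`,
`G^K_{t,μ}(p) ≤ A/2 + (A Σᵢ Kᵢ/m)/E_p` with `A = |t| + Σᵢ |μᵢ|`
(`{κ}₊ ≤ A`, `√y ≤ (1+y)/2`, `E^K_p ≥ m E_p`). [cite: KLS1988JSP, eqs. (6)-(9)] -/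
theorem heisAnisoKlsIntegrand_le_inv_dispersion {m : ℝ} (hm : 0 < m)
    (hmK : ∀ i, m ≤ K i) (t : ℝ) (μ : Fin d → ℝ) {p : Fin d → ℝ} (hp : p ∈ brillouin d)
    (hp0 : p ≠ 0) :
    heisAnisoKlsIntegrand K t μ p ≤
      (|t| + ∑ i, |μ i|) / 2 + (|t| + ∑ i, |μ i|) * ((∑ i, K i) / m) / dispersion p := by
  have hK : ∀ i, 0 < K i := fun i => hm.trans_le (hmK i)
  set κ : ℝ := ∑ i, K i with hκ_def
  set A : ℝ := |t| + ∑ i, |μ i| with hA_def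
  have hA : 0 ≤ A := by positivity
  have hκ : 0 ≤ κ := sum_nonneg fun i _ => (hK i).le
  have hE : 0 < dispersion p := dispersion_pos_of_mem_brillouin hp hp0
  have hmE : m * dispersion p ≤ NVectorAniso.anisoDispersion K p :=
    mul_dispersion_le_anisoDispersion hmK p
  have hEK : 0 < NVectorAniso.anisoDispersion K p := lt_of_lt_of_le (by positivity) hmE
  -- the positive part of the kernel
  have hker : max (t - ∑ i, μ i * Real.cos (p i)) 0 ≤ A := by
    refine max_le ?_ hA
    calc t - ∑ i, μ i * Real.cos (p i) ≤ |t| + ∑ i, |μ i * Real.cos (p i)| := by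
          have h1 := le_abs_self t
          have h2 : -∑ i, μ i * Real.cos (p i) ≤ ∑ i, |μ i * Real.cos (p i)| := by
            rw [← sum_neg_distrib]
            exact sum_le_sum fun i _ => (neg_le_abs _)
          linarith
      _ ≤ A := by
          rw [hA_def]
          have hs : ∑ i, |μ i * Real.cos (p i)| ≤ ∑ i, |μ i| := sum_le_sum fun i _ => by
            rw [abs_mul]
            exact mul_le_of_le_one_right (abs_nonneg _) (Real.abs_cos_le_one _)
          linarith
  -- the square root
  have hN : ∑ i, K i * (1 + Real.cos (p i)) ≤ 2 * κ := by
    rw [hκ_def, mul_sum]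
    exact sum_le_sum fun i _ => by nlinarith [hK i, Real.cos_le_one (p i)]
  have hN0 : 0 ≤ ∑ i, K i * (1 + Real.cos (p i)) :=
    sum_nonneg fun i _ => mul_nonneg (hK i).le (by linarith [Real.neg_one_le_cos (p i)])
  set y : ℝ := (∑ i, K i * (1 + Real.cos (p i))) / NVectorAniso.anisoDispersion K p with hy_def
  have hy : 0 ≤ y := div_nonneg hN0 hEK.le
  have hsqrt : Real.sqrt y ≤ (1 + y) / 2 := by
    nlinarith [Real.sq_sqrt hy, Real.sqrt_nonneg y, sq_nonneg (Real.sqrt y - 1)]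
  have hy' : y ≤ 2 * κ / (m * dispersion p) := by
    rw [hy_def]
    calc (∑ i, K i * (1 + Real.cos (p i))) / NVectorAniso.anisoDispersion K p
        ≤ (2 * κ) / NVectorAniso.anisoDispersion K p := div_le_div_of_nonneg_right hN hEK.le
      _ ≤ 2 * κ / (m * dispersion p) :=
          div_le_div_of_nonneg_left (by positivity) (by positivity) hmE
  unfold heisAnisoKlsIntegrand
  rw [← hy_def]
  calc max (t - ∑ i, μ i * Real.cos (p i)) 0 * Real.sqrt y ≤ A * ((1 + y) / 2) :=
        mul_le_mul hker hsqrt (Real.sqrt_nonneg _) hA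
    _ ≤ A * ((1 + 2 * κ / (m * dispersion p)) / 2) := by
        refine mul_le_mul_of_nonneg_left ?_ hA
        linarith
    _ = A / 2 + A * (κ / m) / dispersion p := by
        field_simp

end Integrand

/-! ### The Riemann sum as a punctured lattice average of the integrand -/

section Shift

variable (k : ℕ) [NeZero (2 * k)]

/-- **The substitution `q = p + Q`**: on the even torus,
`𝓦^K_{t,μ}(2k) = (2k)^{-d} Σ_{p ≠ 0} G^K_{t,μ}(2πp/2k)`. [Kennedy–Lieb–Shastry 1988, after eq. (19)
("changes `S_q` to `S_{q-Q}`")] [cite: KLS1988JSP, eqs. (6)-(9), (19)] -/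
theorem heisAnisoKlsRiemannSum_eq_shift (K : Fin d → ℝ) (t : ℝ) (μ : Fin d → ℝ) :
    heisAnisoKlsRiemannSum K t μ (2 * k) =
      (∑ p ∈ (univ : Finset (TorusSite d (2 * k))).erase 0,
        heisAnisoKlsIntegrand K t μ (latticeMomentum (2 * k) p)) / ((2 * k : ℕ) : ℝ) ^ d := by
  rw [heisAnisoKlsRiemannSum_of_neZero,
    ← sum_erase_neelIndex_shift k (fun p => heisAnisoKlsIntegrand K t μ (latticeMomentum (2 * k) p))]
  refine congrArg (· / ((2 * k : ℕ) : ℝ) ^ d) (sum_congr rfl fun q _ => ?_)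
  have hc : ∀ i, Real.cos (latticeMomentum (2 * k) q i) =
      -Real.cos (latticeMomentum (2 * k) (q - neelIndex (2 * k)) i) := fun i => by
    rw [cos_latticeMomentum_sub_neelIndex k q i, neg_neg]
  have hker : heisAnisoKernel t μ (2 * k) q =
      t - ∑ i, μ i * Real.cos (latticeMomentum (2 * k) (q - neelIndex (2 * k)) i) := by
    rw [heisAnisoKernel, sub_eq_add_neg, ← sum_neg_distrib]
    exact congrArg (t + ·) (sum_congr rfl fun i _ => by rw [hc i]; ring)
  have hE : NVectorAniso.anisoDispersion K (latticeMomentum (2 * k) q) =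
      ∑ i, K i * (1 + Real.cos (latticeMomentum (2 * k) (q - neelIndex (2 * k)) i)) := by
    rw [NVectorAniso.anisoDispersion]
    exact sum_congr rfl fun i _ => by rw [hc i]; ring
  rw [heisAnisoKlsIntegrand, hker, hE]

end Shift

/-! ### Sums to integrals along the even sides (`d ≥ 3`) -/

section SumsToIntegrals

/-- `G^K_{t,μ}` is continuous off the origin of the Brillouin zone (`K > 0`, `d ≥ 1`).
[cite: KLS1988JSP, eqs. (6)-(9)] -/
theorem continuousOn_heisAnisoKlsIntegrand (hd : 1 ≤ d) {K : Fin d → ℝ} (hK : ∀ i, 0 < K i)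
    (t : ℝ) (μ : Fin d → ℝ) : ContinuousOn (heisAnisoKlsIntegrand K t μ) (brillouin d \ {0}) := by
  obtain ⟨i₀, -, hi₀⟩ := exists_min_image univ K ⟨⟨0, by omega⟩, mem_univ _⟩
  have hm : 0 < K i₀ := hK i₀
  have hmK : ∀ i, K i₀ ≤ K i := fun i => hi₀ i (mem_univ i)
  intro p hp
  have hp0 : p ≠ 0 := fun h => hp.2 h
  have hE : 0 < dispersion p := dispersion_pos_of_mem_brillouin hp.1 hp0
  have hEK : 0 < NVectorAniso.anisoDispersion K p :=
    lt_of_lt_of_le (by positivity) (mul_dispersion_le_anisoDispersion hmK p)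
  exact (continuousAt_heisAnisoKlsIntegrand K t μ hEK).continuousWithinAt

/-- **`G^K_{t,μ}` is integrable on the Brillouin zone for `d ≥ 3`** (the `1/E` majorant and the
tree's `PuncturedRiemannSum.integrableOn_brillouin_of_norm_le_inv_dispersion`): the integral `𝓘^K_{t,μ}` is a genuine
Lebesgue integral. [cite: KLS1988JSP, p. 1023] -/
theorem integrableOn_heisAnisoKlsIntegrand (hd3 : 3 ≤ d) {K : Fin d → ℝ} (hK : ∀ i, 0 < K i)
    (t : ℝ) (μ : Fin d → ℝ) : IntegrableOn (heisAnisoKlsIntegrand K t μ) (brillouin d) volume := by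
  have hd : 1 ≤ d := by omega
  obtain ⟨i₀, -, hi₀⟩ := exists_min_image univ K ⟨⟨0, by omega⟩, mem_univ _⟩
  have hm : 0 < K i₀ := hK i₀
  have hmK : ∀ i, K i₀ ≤ K i := fun i => hi₀ i (mem_univ i)
  refine PuncturedRiemannSum.integrableOn_brillouin_of_norm_le_inv_dispersion hd3
    (continuousOn_heisAnisoKlsIntegrand hd hK t μ) (C₀ := (|t| + ∑ i, |μ i|) / 2)
    (C₁ := (|t| + ∑ i, |μ i|) * ((∑ i, K i) / K i₀)) fun p hp hp0 => ?_
  rw [Real.norm_of_nonneg (heisAnisoKlsIntegrand_nonneg K t μ p)]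
  exact heisAnisoKlsIntegrand_le_inv_dispersion hm hmK t μ hp hp0

/-- `𝓘^K_{t,μ} ≥ 0`. [cite: KLS1988JSP, eqs. (6)-(9)] -/
theorem heisAnisoKlsIntegral_nonneg (K : Fin d → ℝ) (t : ℝ) (μ : Fin d → ℝ) :
    0 ≤ heisAnisoKlsIntegral K t μ :=
  div_nonneg (integral_nonneg fun p => heisAnisoKlsIntegrand_nonneg K t μ p) (by positivity)

/-- **"Passing from sums to integrals"** for the two-sum-rule integrand, `d ≥ 3`, `K > 0`: for every
`ε > 0` there is `L₀` with `|𝓦^K_{t,μ}(2k) - 𝓘^K_{t,μ}| ≤ ε` for all `2k ≥ L₀`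
(`PuncturedRiemannSum.momentumAverage_singular_approx` with the majorant
`A/2 + (AΣK/min K)/E_p`). [cite: KLS1988PRL, before eq. (2)] [cite: KLS1988JSP, p. 1023] -/
theorem heisAnisoKlsRiemannSum_approx (hd3 : 3 ≤ d) {K : Fin d → ℝ} (hK : ∀ i, 0 < K i) (t : ℝ)
    (μ : Fin d → ℝ) {ε : ℝ} (hε : 0 < ε) :
    ∃ L₀ : ℕ, ∀ k : ℕ, L₀ ≤ 2 * k → 2 ≤ k →
      |heisAnisoKlsRiemannSum K t μ (2 * k) - heisAnisoKlsIntegral K t μ| ≤ ε := by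
  have hd : 1 ≤ d := by omega
  obtain ⟨i₀, -, hi₀⟩ := exists_min_image univ K ⟨⟨0, by omega⟩, mem_univ _⟩
  have hm : 0 < K i₀ := hK i₀
  have hmK : ∀ i, K i₀ ≤ K i := fun i => hi₀ i (mem_univ i)
  have hκ0 : 0 ≤ ∑ i, K i := sum_nonneg fun i _ => (hK i).le
  set A : ℝ := |t| + ∑ i, |μ i| with hA_def
  have hA : 0 ≤ A := by positivity
  have hG : ContinuousOn (heisAnisoKlsIntegrand K t μ) (brillouin d \ {0}) :=
    continuousOn_heisAnisoKlsIntegrand hd hK t μ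
  have hB : ∀ p ∈ brillouin d, p ≠ 0 →
      ‖heisAnisoKlsIntegrand K t μ p‖ ≤ A / 2 + A * ((∑ i, K i) / K i₀) / dispersion p := by
    intro p hp hp0
    rw [Real.norm_of_nonneg (heisAnisoKlsIntegrand_nonneg K t μ p)]
    exact heisAnisoKlsIntegrand_le_inv_dispersion hm hmK t μ hp hp0
  obtain ⟨L₀, hL₀⟩ := PuncturedRiemannSum.momentumAverage_singular_approx hd3
    (G := heisAnisoKlsIntegrand K t μ) (by positivity : (0 : ℝ) ≤ A / 2) (by positivity) hG hB
    (heisAnisoKlsIntegrand_add_two_pi_mul_int K t μ) hε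
  refine ⟨L₀, fun k hk hk2 => ?_⟩
  haveI : NeZero (2 * k) := ⟨by omega⟩
  have h := hL₀ (2 * k) (even_two_mul k) hk
  have hLd : (((2 * k) ^ d : ℕ) : ℝ) = ((2 * k : ℕ) : ℝ) ^ d := by push_cast; ring
  rw [smul_eq_mul, smul_eq_mul, hLd, inv_mul_eq_div, inv_mul_eq_div,
    ← heisAnisoKlsRiemannSum_eq_shift k, Real.norm_eq_abs] at h
  exact h

/-- Consequently: if `𝓘^K_{t,μ} < W̄` then eventually (in `k`) `𝓦^K_{t,μ}(2k) ≤ W̄`.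
[cite: KLS1988PRL, before eq. (2)] [cite: KLS1988JSP, p. 1023] -/
theorem heisAnisoKlsRiemannSum_eventually_le (hd3 : 3 ≤ d) {K : Fin d → ℝ} (hK : ∀ i, 0 < K i)
    (t : ℝ) (μ : Fin d → ℝ) {Wbar : ℝ} (hI : heisAnisoKlsIntegral K t μ < Wbar) :
    ∀ᶠ k : ℕ in atTop, heisAnisoKlsRiemannSum K t μ (2 * k) ≤ Wbar := by
  obtain ⟨L₀, hL₀⟩ := heisAnisoKlsRiemannSum_approx hd3 hK t μ
    (ε := Wbar - heisAnisoKlsIntegral K t μ) (by linarith)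
  filter_upwards [eventually_ge_atTop (L₀ + 2)] with k hk
  have h := hL₀ k (by omega) (by omega)
  rw [abs_le] at h
  linarith [h.2]

end SumsToIntegrals

/-! ### Néel order from a certified evaluation of the integrals -/

section Order

/-- **Néel long-range order of the model (5) from certified values of the two-sum-rule integrals**
(`d ≥ 3`): if `K > 0` has a largest coupling `K_{i₀}` carried by the directions of `T`
(`κ_T = Σ_{i∈T}Kᵢ > 0`), and finitely many triples `(tⱼ, λⱼ, W̄ⱼ)` with `tⱼ - λⱼΣK > 0` and
`𝓘^K_{tⱼ,λⱼK} < W̄ⱼ`, together with a margin `δ`, satisfy the real-arithmetic certificate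
"every `e` of the window `[(S²/3)ΣK, S²ΣK]` admits `j` with
`δ(tⱼ - λⱼΣK) ≤ tⱼS(S+1)/3 - λⱼe - (e/2κ_T)^{1/2}W̄ⱼ`", then along the even tori `(ℤ/2kℤ)^d` the
staggered order parameter satisfies `liminf |Λ|⁻² Σ_{x,y}(-1)^{x+y}⟨𝐒_x·𝐒_y⟩_{GS} ≥ 3δ`.
This is [KLS1988JSP]'s Theorem for the model (5) ("Néel order if `1 ≥ r ≥ 0.16` and `S = 1/2`")
with its numerical step — the evaluation of (6)–(9) — as the explicit input.
[cite: KLS1988JSP, eqs. (5)-(9), p. 1023] -/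
theorem heisAniso_neelLRO_of_integral_certificate (hd3 : 3 ≤ d) {n : ℕ} {K : Fin d → ℝ}
    (hK : ∀ i, 0 < K i) {i₀ : Fin d} (hmax : ∀ i, K i ≤ K i₀) (T : Finset (Fin d))
    (hT : ∀ i ∈ T, K i = K i₀) (hκ : 0 < ∑ i ∈ T, K i)
    {ι : Type*} (J : Finset ι) (t lam Wbar : ι → ℝ) (hpos : ∀ j ∈ J, 0 < t j - lam j * ∑ i, K i)
    (hI : ∀ j ∈ J, heisAnisoKlsIntegral K (t j) (fun i => lam j * K i) < Wbar j)
    {δ : ℝ}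
    (hcert : ∀ e : ℝ, ((n : ℝ) / 2) ^ 2 / 3 * ∑ i, K i ≤ e → e ≤ ((n : ℝ) / 2) ^ 2 * ∑ i, K i →
      ∃ j ∈ J, δ * (t j - lam j * ∑ i, K i) ≤
        t j * ((n : ℝ) / 2 * ((n : ℝ) / 2 + 1) / 3) - lam j * e -
          Real.sqrt (e / (2 * ∑ i ∈ T, K i)) * Wbar j) :
    3 * δ ≤ liminf (fun k : ℕ =>
      (∑ x : TorusSite d (2 * k + 2), ∑ y : TorusSite d (2 * k + 2),
        (-1 : ℝ) ^ (∑ i, (x i).val) * (-1) ^ (∑ i, (y i).val) *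
          ∑ α : Fin 3, heisAnisoGroundCorr α (2 * k + 2) n K x y) /
        ((2 * k + 2 : ℕ) : ℝ) ^ (2 * d)) atTop :=
  heisAniso_neelLRO_of_certificate hK hmax T hT hκ J t lam Wbar hpos
    (fun j hj => heisAnisoKlsRiemannSum_eventually_le hd3 hK (t j) _ (hI j hj)) hcert

/-- **Néel long-range order from certified integrals, direction-resolved multipliers** (`d ≥ 3`):
the `liminf` statement of `heisAniso_neelLRO_of_dirCertificate` with the eventual Riemann-sum
bounds replaced by `𝓘^K_{tⱼ,μⱼ} < W̄ⱼ`. [cite: KLS1988JSP, eqs. (5)-(9), p. 1023] -/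
theorem heisAniso_neelLRO_of_integral_dirCertificate (hd3 : 3 ≤ d) {n : ℕ} {K : Fin d → ℝ}
    (hK : ∀ i, 0 < K i) {i₀ : Fin d} (hmax : ∀ i, K i ≤ K i₀) {ι : Type*} (J : Finset ι)
    (t : ι → ℝ) (μ : ι → Fin d → ℝ) (Wbar : ι → ℝ) (hpos : ∀ j ∈ J, 0 < t j - ∑ i, μ j i)
    (hI : ∀ j ∈ J, heisAnisoKlsIntegral K (t j) (μ j) < Wbar j)
    {δ : ℝ}
    (hcert : ∀ ε : Fin d → ℝ, (∀ i, ε i ≤ 0) → (∀ i, ε i₀ ≤ ε i) →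
      (∀ i, K i = K i₀ → ε i = ε i₀) →
      (∑ i, K i * ε i ≤ -(((n : ℝ) / 2) ^ 2 / 3) * ∑ i, K i) → (∀ i, -((n : ℝ) / 2) ^ 2 ≤ ε i) →
      ∃ j ∈ J, δ * (t j - ∑ i, μ j i) ≤
        t j * ((n : ℝ) / 2 * ((n : ℝ) / 2 + 1) / 3) + ∑ i, μ j i * ε i -
          Real.sqrt (-ε i₀ / 2) * Wbar j) :
    3 * δ ≤ liminf (fun k : ℕ =>
      (∑ x : TorusSite d (2 * k + 2), ∑ y : TorusSite d (2 * k + 2),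
        (-1 : ℝ) ^ (∑ i, (x i).val) * (-1) ^ (∑ i, (y i).val) *
          ∑ α : Fin 3, heisAnisoGroundCorr α (2 * k + 2) n K x y) /
        ((2 * k + 2 : ℕ) : ℝ) ^ (2 * d)) atTop :=
  heisAniso_neelLRO_of_dirCertificate hK hmax J t μ Wbar hpos
    (fun j hj => heisAnisoKlsRiemannSum_eventually_le hd3 hK (t j) (μ j) (hI j hj)) hcert

/-- **The layered model of Kennedy–Lieb–Shastry** ([KLS1988JSP] eq. (5): couplings `1, 1, r` on the
cubic lattice, `0 < r ≤ 1`), spin `S = n/2`: Néel long-range order of the ground states on the even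
tori `(ℤ/2kℤ)³` follows from finitely many certified upper bounds `W̄ⱼ > 𝓘^{(1,1,r)}_{tⱼ,λⱼ(1,1,r)}`
of the integrals of (6)–(9) (`κ_T = 2`, `ΣK = 2 + r`, kernel `t + λ(cos q₁ + cos q₂ + r cos q₃)`)
and a real-arithmetic certificate on the energy window `[(2+r)S²/3, (2+r)S²]`
(for `S = ½`: KLS's `e₀ ∈ [(2+r)/4, …]`, `f^r_q² = e₀E^r_q/12E^r_{q-Q}`, "max `I < 1/4`").
[cite: KLS1988JSP, eqs. (5)-(9), p. 1023] -/
theorem layeredHeis_neelLRO_of_certificate {n : ℕ} {r : ℝ} (hr0 : 0 < r) (hr1 : r ≤ 1)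
    {ι : Type*} (J : Finset ι) (t lam Wbar : ι → ℝ) (hpos : ∀ j ∈ J, 0 < t j - lam j * (2 + r))
    (hI : ∀ j ∈ J, heisAnisoKlsIntegral ![(1 : ℝ), 1, r] (t j) (fun i => lam j * ![(1 : ℝ), 1, r] i) < Wbar j)
    {δ : ℝ}
    (hcert : ∀ e : ℝ, ((n : ℝ) / 2) ^ 2 / 3 * (2 + r) ≤ e → e ≤ ((n : ℝ) / 2) ^ 2 * (2 + r) →
      ∃ j ∈ J, δ * (t j - lam j * (2 + r)) ≤
        t j * ((n : ℝ) / 2 * ((n : ℝ) / 2 + 1) / 3) - lam j * e - Real.sqrt (e / 4) * Wbar j) :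
    3 * δ ≤ liminf (fun k : ℕ =>
      (∑ x : TorusSite 3 (2 * k + 2), ∑ y : TorusSite 3 (2 * k + 2),
        (-1 : ℝ) ^ (∑ i, (x i).val) * (-1) ^ (∑ i, (y i).val) *
          ∑ α : Fin 3, heisAnisoGroundCorr α (2 * k + 2) n ![(1 : ℝ), 1, r] x y) /
        ((2 * k + 2 : ℕ) : ℝ) ^ (2 * 3)) atTop := by
  set K : Fin 3 → ℝ := ![(1 : ℝ), 1, r] with hKdef
  have hK0 : K 0 = 1 := rfl
  have hK1 : K 1 = 1 := rfl
  have hK2 : K 2 = r := rfl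
  have hK : ∀ i, 0 < K i := by
    intro i; fin_cases i <;> simp [hKdef, hr0]
  have hmax : ∀ i, K i ≤ K 0 := by
    intro i; fin_cases i <;> simp [hKdef, hr1]
  have hT : ∀ i ∈ ({0, 1} : Finset (Fin 3)), K i = K 0 := by
    intro i hi
    simp only [mem_insert, mem_singleton] at hi
    rcases hi with rfl | rfl
    · rfl
    · rw [hK0, hK1]
  have hsumT : ∑ i ∈ ({0, 1} : Finset (Fin 3)), K i = 2 := by
    rw [sum_pair (by decide : (0 : Fin 3) ≠ 1), hK0, hK1]
    norm_num
  have hsum : ∑ i, K i = 2 + r := by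
    rw [Fin.sum_univ_three, hK0, hK1, hK2]
    norm_num
  have hκ : 0 < ∑ i ∈ ({0, 1} : Finset (Fin 3)), K i := by rw [hsumT]; norm_num
  refine heisAniso_neelLRO_of_integral_certificate (le_refl 3) hK hmax {0, 1} hT hκ J t lam Wbar
    (fun j hj => by rw [hsum]; exact hpos j hj) hI (fun e he1 he2 => ?_)
  rw [hsum] at he1 he2
  obtain ⟨j, hj, hc⟩ := hcert e he1 he2
  refine ⟨j, hj, ?_⟩
  rw [hsum, hsumT, show (2 : ℝ) * 2 = 4 by norm_num]
  exact hc

end Order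

end Literature.MathematicalPhysics.QuantumLattice
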